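import Summits.HubbardSuperconductivity.HubbardLadder.ClusterCutFrames
import HarnessLib

/-!
# Cluster pair-cuts, kernel certificates §4: merge-join block builder and the row checks of the literal block `Q = c·(B + t·G)`

HONEST FRAMING: ladder R1–R4 with certified numbers; no claim on H/H₀.  Cell pub-hubbard, lane r2-eng-1 (g13); design memo
`pub-hubbard-r2-eng-1/psdcert-g12/C-SPEC-g12.md` §7 + `pub-hubbard-r2-eng-1/it4cert-g13/README.md`.  Infrastructure for the cluster
pair-cut road ([C](c) → (d) seam); it certifies no cell by itself.  All statements [folklore].

`sortedSV` / `dropLT` / `dotSorted` + `dotSorted_eq`: a MERGE-JOIN sparse dot product (structural recursion, linear work) equal to the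
tree's `bmatEntryFast` contraction on sorted inputs (sortedness is itself CHECKED by the kernel, never assumed); `qRowOK` / `qRowsOK` /
`qBand` + specs and the band-recombination lemmas (`qRowsOK_append`, `qRows_drop_of_band`, `qRows_drop_length`, the pattern of
`PsdCertFactor.ddRows_drop_of_band`): the literal integer block `Q` of a per-piece certificate equals
`c · (bmatEntry P rep_k col_l + t · gmatEntry rep_k col_l)` entrywise, decided by the kernel one row band per declaration.
-/

namespace Summit.HubbardSuperconductivity.HubbardLadder.ClusterCut

/-! ## §4 Row checks of the literal block `Q = B + t·G` against the builders (one kernel declaration per row band) -/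

section QRows

variable {N : ℕ}

/-- The sites of each pair of a `pairsOK` list differ. [folklore] -/
theorem pairsOK_ne {P : NatPairList} (hP : pairsOK N P = true) : ∀ p ∈ P, p.1 ≠ p.2.1 := by
  intro p hp
  simp only [pairsOK, List.all_eq_true, Bool.and_eq_true, decide_eq_true_eq] at hP
  exact (hP p hp).2

/-- Keys strictly increasing (Boolean, structural). [folklore] -/
def sortedSV : SVec → Bool
  | [] => true
  | [_] => true
  | (k, _) :: (k', c') :: v => decide (k < k') && sortedSV ((k', c') :: v)

/-- Head of a sorted sparse vector: the tail is sorted and all its keys are larger. [folklore] -/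
theorem sortedSV_cons {e : ℕ × ℤ} {v : SVec} (h : sortedSV (e :: v) = true) :
    sortedSV v = true ∧ ∀ e' ∈ v, e.1 < e'.1 := by
  induction v generalizing e with
  | nil => exact ⟨rfl, fun e' he' => absurd he' (List.not_mem_nil)⟩
  | cons e2 v ih =>
    obtain ⟨k, c⟩ := e
    obtain ⟨k2, c2⟩ := e2
    simp only [sortedSV, Bool.and_eq_true, decide_eq_true_eq] at h
    obtain ⟨hlt, hrest⟩ := h
    obtain ⟨_, hall⟩ := ih hrest
    refine ⟨hrest, fun e' he' => ?_⟩
    rcases List.mem_cons.mp he' with rfl | hm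
    · exact hlt
    · exact lt_trans hlt (hall e' hm)

/-- A key below every key of the list evaluates to `0`. [folklore] -/
theorem evalSV_eq_zero_of_lt {w : SVec} {q : ℕ} (h : ∀ e ∈ w, q < e.1) : evalSV w q = 0 := by
  induction w with
  | nil => rfl
  | cons e w ih =>
    obtain ⟨k, c⟩ := e
    have hk : q < k := h (k, c) (by simp)
    simp only [evalSV]
    rw [if_neg (by omega), ih (fun e' he' => h e' (List.mem_cons_of_mem _ he')), add_zero]

/-- Drop the prefix of keys `< k`. [folklore] -/
def dropLT (k : ℕ) : SVec → SVec
  | [] => []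
  | (k', c') :: w => if k' < k then dropLT k w else (k', c') :: w

/-- `dropLT` of a sorted vector: sorted, all keys `≥ k`, and evaluations at keys `≥ k` unchanged. [folklore] -/
theorem dropLT_spec (k : ℕ) : ∀ (w : SVec), sortedSV w = true →
    sortedSV (dropLT k w) = true ∧ (∀ e ∈ dropLT k w, k ≤ e.1) ∧ ∀ q, k ≤ q → evalSV (dropLT k w) q = evalSV w q := by
  intro w
  induction w with
  | nil => intro _; exact ⟨rfl, fun e he => absurd he List.not_mem_nil, fun q _ => rfl⟩
  | cons e w ih =>
    intro hs
    obtain ⟨k', c'⟩ := e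
    obtain ⟨hs', hall⟩ := sortedSV_cons hs
    simp only [dropLT]
    by_cases hlt : k' < k
    · rw [if_pos hlt]
      obtain ⟨h1, h2, h3⟩ := ih hs'
      refine ⟨h1, h2, fun q hq => ?_⟩
      rw [h3 q hq]
      simp only [evalSV]
      rw [if_neg (by omega), zero_add]
    · rw [if_neg hlt]
      refine ⟨hs, fun e he => ?_, fun q _ => rfl⟩
      rcases List.mem_cons.mp he with rfl | hm
      · exact not_lt.mp hlt
      · exact le_of_lt (lt_of_le_of_lt (not_lt.mp hlt) (hall e hm))

/-- **Merge-join dot product** of two sorted sparse vectors (structural recursion on the first; linear work). [folklore] -/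
def dotSorted : SVec → SVec → ℤ
  | [], _ => 0
  | (k, c) :: u, w =>
    match dropLT k w with
    | [] => 0
    | (k', c') :: w' => (if k' = k then c * c' else 0) + dotSorted u ((k', c') :: w')

/-- **Semantics of the merge-join**: for sorted inputs, `dotSorted u w = Σ_{(k,c) ∈ u} c · evalSV w k`. [folklore] -/
theorem dotSorted_eq : ∀ (u w : SVec), sortedSV u = true → sortedSV w = true →
    dotSorted u w = (u.map fun e => e.2 * evalSV w e.1).sum := by
  intro u
  induction u with
  | nil => intro w _ _; rfl
  | cons e u ih =>
    intro w hu hw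
    obtain ⟨k, c⟩ := e
    obtain ⟨hu', hukeys⟩ := sortedSV_cons hu
    obtain ⟨hds, hdkeys, hdev⟩ := dropLT_spec k w hw
    simp only [dotSorted, List.map_cons, List.sum_cons]
    -- evaluations of `w` at the keys of `(k,c)::u` may be read off `dropLT k w`
    rw [← hdev k le_rfl]
    have htail : (u.map fun e => e.2 * evalSV w e.1) = u.map fun e => e.2 * evalSV (dropLT k w) e.1 :=
      List.map_congr_left fun e he => by rw [hdev e.1 (le_of_lt (hukeys e he))]
    rw [htail]
    rcases hd : dropLT k w with _ | ⟨⟨k', c'⟩, w'⟩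
    · -- nothing left: every evaluation vanishes
      simp only [evalSV, mul_zero, zero_add]
      simp
    · rw [hd] at hds hdkeys
      simp only
      rw [ih ((k', c') :: w') hu' hds]
      obtain ⟨hw', hw'keys⟩ := sortedSV_cons hds
      have hk' : k ≤ k' := hdkeys (k', c') (by simp)
      -- the head term
      have h0 : evalSV w' k = 0 := evalSV_eq_zero_of_lt fun e he => lt_of_le_of_lt hk' (hw'keys e he)
      simp only [evalSV, h0, add_zero]
      by_cases hkk : k' = k
      · subst hkk; simp
      · simp [hkk]

/-- **Row check for `Q = c·(B + t·G)`**: the sparse `Xint` row of `rep` is sorted, every column is sorted, and the literal row equals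
`c · (dotSorted col xrow + t · gmatEntry rep col)` column by column (`c` = a positive literal scale making the integer PSD certificate's
unit rounding negligible; `dotSorted` = `bmatEntryFast` by the merge-join semantics). [folklore] -/
def qRowOK (P : NatPairList) (c t : ℤ) (rep : ℕ) (cols : List SVec) (row : List ℤ) : Bool :=
  let xr := xrowVec P rep
  sortedSV xr && allPairs (fun q col => sortedSV col && decide (q = c * (dotSorted col xr + t * evalSV col rep))) row cols

/-- Semantics of `qRowOK`: the literal row is `c · (bmatEntry + t · gmatEntry)` column by column. [folklore] -/
theorem qRowOK_spec {P : NatPairList} (hP : ∀ p ∈ P, p.1 ≠ p.2.1) {c t : ℤ} {rep : ℕ} {cols : List SVec} {row : List ℤ}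
    (h : qRowOK P c t rep cols row = true) :
    row.length = cols.length ∧
      ∀ l < cols.length, row.getD l 0 = c * (bmatEntry P rep (cols.getD l []) + t * gmatEntry rep (cols.getD l [])) := by
  unfold qRowOK at h
  simp only [Bool.and_eq_true] at h
  obtain ⟨hxr, hall0⟩ := h
  obtain ⟨hlen, hall⟩ := allPairs_spec _ row cols hall0
  refine ⟨hlen, fun l hl => ?_⟩
  have := hall l hl
  simp only [Bool.and_eq_true, decide_eq_true_eq] at this
  obtain ⟨hcol, hq⟩ := this
  rw [hq, dotSorted_eq _ _ hcol hxr, ← bmatEntryFast_eq P hP]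
  rfl

/-- Row checks for a list of representatives against a list of literal rows (same columns). [folklore] -/
def qRowsOK (P : NatPairList) (c t : ℤ) (cols : List SVec) : List ℕ → List (List ℤ) → Bool
  | [], [] => true
  | r :: rs, row :: rows => qRowOK P c t r cols row && qRowsOK P c t cols rs rows
  | _, _ => false

/-- Semantics of `qRowsOK`: equal lengths and every row passes. [folklore] -/
theorem qRowsOK_spec {P : NatPairList} {c t : ℤ} {cols : List SVec} :
    ∀ (reps : List ℕ) (rows : List (List ℤ)), qRowsOK P c t cols reps rows = true →
      rows.length = reps.length ∧ ∀ k < reps.length, qRowOK P c t (reps.getD k 0) cols (rows.getD k []) = true := by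
  intro reps
  induction reps with
  | nil =>
    intro rows h
    cases rows with
    | nil => exact ⟨rfl, fun k hk => absurd hk (Nat.not_lt_zero _)⟩
    | cons _ _ => simp [qRowsOK] at h
  | cons r rs ih =>
    intro rows h
    cases rows with
    | nil => simp [qRowsOK] at h
    | cons row rows =>
      simp only [qRowsOK, Bool.and_eq_true] at h
      obtain ⟨hlen, hrest⟩ := ih rows h.2
      refine ⟨by simp [hlen], fun k hk => ?_⟩
      cases k with
      | zero => simpa using h.1
      | succ k =>
        simp only [List.getD_cons_succ]
        exact hrest k (by simpa using hk)

/-- **One row band**: representatives / rows `i₀ ≤ k < i₀ + c`. [folklore] -/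
def qBand (P : NatPairList) (c t : ℤ) (cols : List SVec) (reps : List ℕ) (rows : List (List ℤ)) (i0 n : ℕ) : Bool :=
  qRowsOK P c t cols ((reps.drop i0).take n) ((rows.drop i0).take n)

/-- `qRowsOK` over appended lists splits (equal lengths on the first parts). [folklore] -/
theorem qRowsOK_append (P : NatPairList) (c t : ℤ) (cols : List SVec) :
    ∀ (X Y : List ℕ) (A B : List (List ℤ)), X.length = A.length →
      qRowsOK P c t cols (X ++ Y) (A ++ B) = (qRowsOK P c t cols X A && qRowsOK P c t cols Y B) := by
  intro X
  induction X with
  | nil =>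
    intro Y A B h
    cases A with
    | nil => simp [qRowsOK]
    | cons _ _ => simp at h
  | cons r rs ih =>
    intro Y A B h
    cases A with
    | nil => simp at h
    | cons row rows =>
      simp only [List.cons_append, qRowsOK]
      rw [ih Y rows B (by simpa using h), Bool.and_assoc]

/-- **Band recombination**: a passing band `[i₀, i₀ + c)` and a passing remainder from `i₀ + c` give the remainder from `i₀`. [folklore] -/
theorem qRows_drop_of_band {P : NatPairList} {c t : ℤ} {cols : List SVec} {reps : List ℕ} {rows : List (List ℤ)} {n : ℕ}
    (hR : reps.length = n) (hQ : rows.length = n) {i0 w : ℕ} (hband : qBand P c t cols reps rows i0 w = true)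
    (hrest : qRowsOK P c t cols (reps.drop (i0 + w)) (rows.drop (i0 + w)) = true) :
    qRowsOK P c t cols (reps.drop i0) (rows.drop i0) = true := by
  have eR : reps.drop i0 = (reps.drop i0).take w ++ reps.drop (i0 + w) := by
    rw [← List.drop_drop, List.take_append_drop]
  have eQ : rows.drop i0 = (rows.drop i0).take w ++ rows.drop (i0 + w) := by
    rw [← List.drop_drop, List.take_append_drop]
  have hlen : ((reps.drop i0).take w).length = ((rows.drop i0).take w).length := by
    simp [List.length_take, List.length_drop, hR, hQ]
  rw [eR, eQ, qRowsOK_append _ _ _ _ _ _ _ _ hlen]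
  unfold qBand at hband
  rw [hband, Bool.true_and]
  exact hrest

/-- The empty remainder passes. [folklore] -/
theorem qRows_drop_length {P : NatPairList} {c t : ℤ} {cols : List SVec} {reps : List ℕ} {rows : List (List ℤ)} {n : ℕ}
    (hR : reps.length = n) (hQ : rows.length = n) (i0 : ℕ) (hi : n ≤ i0) :
    qRowsOK P c t cols (reps.drop i0) (rows.drop i0) = true := by
  rw [List.drop_eq_nil_of_le (by omega), List.drop_eq_nil_of_le (by omega)]
  rfl

end QRows

end Summit.HubbardSuperconductivity.HubbardLadder.ClusterCut
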